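import Summits.CriticalPhenomena.Ising3D.TaylorRegionCheckHybrid
import Summits.CriticalPhenomena.Ising3D.TaylorRegionBoxInputs
import Summits.CriticalPhenomena.Ising3D.TaylorTableTheorem
import Mathlib.Tactic.Linarith
import Mathlib.Tactic.Ring
import HarnessLib

/-!
# Turnkey HYBRID region certificates and the TABLE theorem's region hypotheses from them
(cell `pub-ising3x`, seat recog-1 gen 11; gate (g2) — the hybrid route of `TaylorRegionCheckHybrid` (exact
per-integer-`j` rows below `E₁`, `(E, θ)` tail tables beyond) packaged like `TaylorRegionCertsH`)

HONEST FRAMING: lottery ticket; floor = tightest certified 3D Ising CFT bounds; no exact-solution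
claim without a proof. Island framing: certified exclusion region at stated derivative order and
assumptions; not a determination of the 3D Ising critical exponents beyond that.

`EvenRegionCertH` / `OddConeRegionCertH`: rational box + weights + parameters (+ six root atoms for the odd cone),
the `MI` box inputs produced inside (`enclQ`, `checkRoot` atoms); `taylorEvenRegion_of_certH`, `oddCone_of_certH`.
For boot-1's `TaylorTable`: `T.evenCertH π`, `T.oddCertH π` (the table's own data plus `EvenRegionParamsH` /
`OddConeParamsH`) and **`TaylorTable.boxExcluded_of_taylorTable_of_certsH`**:
`T.check = true → T.Enclosures → (T.evenCertH πE).check = true → (T.oddCertH πO).check = true → BoxExcluded T.box`.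
Region side SUFFICIENT (λ-averaged termwise conditions, `j` relaxed to real `[0, E]`, interval slack) — the
strength of the float probe's `(E, J)` tables. Elementary glue. [folklore]
-/

namespace Summit.CriticalPhenomena.Ising3D

open Set
open Literature.Analysis.ValidatedNumerics Literature.Analysis.ValidatedNumerics.PolyMP
open Literature.Analysis.ValidatedNumerics.NumericsMP (MI)
open Literature.MathematicalPhysics.QuantumFieldTheory.ConformalBootstrap3D

/-! ### Turnkey even -/

/-- Rational data of an exact even-region certificate. [folklore] -/
structure EvenRegionCertH where
  S : ℕ
  box : BoxQ
  l : List (ℕ × ℕ)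
  cQ : Fin 5 → ℕ × ℕ → ℚ
  E0 : ℚ
  E1 : ℚ
  J1 : ℕ
  ccQ : ℚ
  N : ℕ
  R : ℕ
  prmX : HSParams
  prmY : HSParams
  prmD : HSParams
  dPj : ℕ

namespace EvenRegionCertH

/-- [folklore] -/
def data (c : EvenRegionCertH) : EvenRegionDataH where
  S := c.S
  l := c.l
  cQ := c.cQ
  sσI := enclQ c.S c.box.σlo c.box.σhi
  sεI := enclQ c.S c.box.εlo c.box.εhi
  sbI := enclQ c.S ((c.box.σlo + c.box.εlo) / 2) ((c.box.σhi + c.box.εhi) / 2)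
  E0 := c.E0
  E1 := c.E1
  J1 := c.J1
  ccQ := c.ccQ
  N := c.N
  R := c.R
  prmX := c.prmX
  prmY := c.prmY
  prmD := c.prmD
  dPj := c.dPj

/-- [folklore] -/
def check (c : EvenRegionCertH) : Bool := decide c.l.Nodup && c.data.check

end EvenRegionCertH

/-- **Hybrid even region for a rational box from one Boolean.** [folklore] -/
theorem taylorEvenRegion_of_certH (c : EvenRegionCertH) (h : c.check = true) :
    TaylorEvenRegion (taylorCrossing (1 / 2) (1 / 2) c.l.toFinset fun i ab => (c.cQ i ab : ℝ))
      (Icc (c.box.σlo : ℝ) c.box.σhi ×ˢ Icc (c.box.εlo : ℝ) c.box.εhi) ((c.E0 : ℚ) : ℝ) := by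
  simp only [EvenRegionCertH.check, Bool.and_eq_true, decide_eq_true_eq] at h
  obtain ⟨hl, hd⟩ := h
  refine taylorEvenRegion_of_evenRegionCheckH c.data hl _ (fun p hp => ?_) hd
  obtain ⟨h1, h2, h3, h4⟩ := BoxQ.bounds (B := c.box) hp
  refine ⟨mem_enclQ _ h1 h2, mem_enclQ _ h3 h4, mem_enclQ _ ?_ ?_⟩
  · push_cast; linarith
  · push_cast; linarith

/-! ### Turnkey odd -/

/-- Rational data of an exact odd-cone certificate. [folklore] -/
structure OddConeRegionCertH where
  S : ℕ
  box : BoxQ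
  l : List (ℕ × ℕ)
  cQ : Fin 5 → ℕ × ℕ → ℚ
  lψ : List (ℕ × ℕ)
  ψQ : ℕ × ℕ → ℚ
  κ₀Q : ℚ
  k1lo : RootAtom
  k1hi : RootAtom
  k2lo : RootAtom
  k2hi : RootAtom
  k3lo : RootAtom
  k3hi : RootAtom
  E0 : ℚ
  E1 : ℚ
  J1 : ℕ
  ccQ : ℚ
  N : ℕ
  R : ℕ
  prmM1 : HSParams
  prmM2 : HSParams
  prmR1 : HSParams
  prmR2 : HSParams
  dPj : ℕ

namespace OddConeRegionCertH

/-- [folklore] -/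
def data (c : OddConeRegionCertH) : OddConeRegionDataH where
  S := c.S
  l := c.l
  cQ := c.cQ
  lψ := c.lψ
  ψQ := c.ψQ
  κ₀Q := c.κ₀Q
  sσI := enclQ c.S c.box.σlo c.box.σhi
  sbI := enclQ c.S ((c.box.σlo + c.box.εlo) / 2) ((c.box.σhi + c.box.εhi) / 2)
  stI := enclQ c.S (c.box.σlo - c.box.εhi) (c.box.σhi - c.box.εlo)
  K1 := MI.span c.k1hi.R c.k1lo.R
  K2 := MI.span c.k2hi.R c.k2lo.R
  K3 := MI.span c.k3lo.R c.k3hi.R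
  E0 := c.E0
  E1 := c.E1
  J1 := c.J1
  ccQ := c.ccQ
  N := c.N
  R := c.R
  prmM1 := c.prmM1
  prmM2 := c.prmM2
  prmR1 := c.prmR1
  prmR2 := c.prmR2
  dPj := c.dPj

/-- [folklore] -/
def check (c : OddConeRegionCertH) : Bool :=
  decide (0 < c.S) && decide c.l.Nodup && decide c.lψ.Nodup &&
  c.k1lo.ok c.S 1 2 (c.box.σlo + c.box.εlo) && c.k1hi.ok c.S 1 2 (c.box.σhi + c.box.εhi) &&
  c.k2lo.ok c.S 1 2 (c.box.εlo - c.box.σhi) && c.k2hi.ok c.S 1 2 (c.box.εhi - c.box.σlo) &&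
  c.k3lo.ok c.S 2 1 (2 * c.box.εlo) && c.k3hi.ok c.S 2 1 (2 * c.box.εhi) &&
  c.data.check

end OddConeRegionCertH

/-- **Hybrid odd cone for a rational box from one Boolean.** [folklore] -/
theorem oddCone_of_certH (c : OddConeRegionCertH) (h : c.check = true) :
    ∀ p ∈ Icc (c.box.σlo : ℝ) c.box.σhi ×ˢ Icc (c.box.εlo : ℝ) c.box.εhi, ∀ (E : ℝ) (j : ℕ),
      ((c.E0 : ℚ) : ℝ) ≤ E → (j : ℝ) ≤ E →
      OddConeAt (taylorCrossing (1 / 2) (1 / 2) c.l.toFinset fun i ab => (c.cQ i ab : ℝ))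
        (∑ ab ∈ c.lψ.toFinset, (c.ψQ ab : ℝ) • taylorCoeffAt (1 / 2) (1 / 2) ab) (c.κ₀Q : ℝ) p.1 p.2 E j := by
  simp only [OddConeRegionCertH.check, Bool.and_eq_true, decide_eq_true_eq] at h
  obtain ⟨⟨⟨⟨⟨⟨⟨⟨⟨hS, hl⟩, hlψ⟩, hk1lo⟩, hk1hi⟩, hk2lo⟩, hk2hi⟩, hk3lo⟩, hk3hi⟩, hd⟩ := h
  refine oddCone_of_oddConeRegionCheckH c.data hl hlψ _ (fun p hp => ?_) hd
  obtain ⟨h1, h2, h3, h4⟩ := BoxQ.bounds (B := c.box) hp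
  refine ⟨mem_enclQ _ h1 h2, mem_enclQ _ (by push_cast; linarith) (by push_cast; linarith),
    mem_enclQ _ (by push_cast; linarith) (by push_cast; linarith), ?_, ?_, ?_⟩
  · exact mem_half_rpow_span hS hk1lo hk1hi (by push_cast; linarith) (by push_cast; linarith)
  · exact mem_half_rpow_span hS hk2lo hk2hi (by push_cast; linarith) (by push_cast; linarith)
  · exact mem_half_rpow_neg_span hS hk3lo hk3hi (y := 2 * p.2) (by push_cast; linarith) (by push_cast; linarith)

/-! ### The TABLE theorem's region hypotheses from exact certificates -/

/-- Region parameters, even sector, exact route. [folklore] -/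
structure EvenRegionParamsH where
  S : ℕ
  E1 : ℚ
  J1 : ℕ
  ccQ : ℚ
  N : ℕ
  R : ℕ
  prmX : HSParams
  prmY : HSParams
  prmD : HSParams
  dPj : ℕ

/-- Region parameters, odd cone, exact route. [folklore] -/
structure OddConeParamsH where
  S : ℕ
  E1 : ℚ
  J1 : ℕ
  ccQ : ℚ
  N : ℕ
  R : ℕ
  dPj : ℕ
  k1lo : RootAtom
  k1hi : RootAtom
  k2lo : RootAtom
  k2hi : RootAtom
  k3lo : RootAtom
  k3hi : RootAtom
  prmM1 : HSParams
  prmM2 : HSParams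
  prmR1 : HSParams
  prmR2 : HSParams

namespace TaylorTable

variable (T : TaylorTable)

/-- The exact even-region certificate of a table. [folklore] -/
def evenCertH (π : EvenRegionParamsH) : EvenRegionCertH where
  S := π.S
  box := ⟨T.σlo, T.σhi, T.εlo, T.εhi⟩
  l := T.L
  cQ := T.c
  E0 := T.E₀
  E1 := π.E1
  J1 := π.J1
  ccQ := π.ccQ
  N := π.N
  R := π.R
  prmX := π.prmX
  prmY := π.prmY
  prmD := π.prmD
  dPj := π.dPj

/-- The exact odd-cone certificate of a table. [folklore] -/
def oddCertH (π : OddConeParamsH) : OddConeRegionCertH where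
  S := π.S
  box := ⟨T.σlo, T.σhi, T.εlo, T.εhi⟩
  l := T.L
  cQ := T.c
  lψ := T.Lψ
  ψQ := T.ψ
  κ₀Q := T.κ₀
  k1lo := π.k1lo
  k1hi := π.k1hi
  k2lo := π.k2lo
  k2hi := π.k2hi
  k3lo := π.k3lo
  k3hi := π.k3hi
  E0 := T.E_T
  E1 := π.E1
  J1 := π.J1
  ccQ := π.ccQ
  N := π.N
  R := π.R
  prmM1 := π.prmM1
  prmM2 := π.prmM2
  prmR1 := π.prmR1
  prmR2 := π.prmR2
  dPj := π.dPj

/-- [folklore] -/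
theorem evenRegion_of_evenCertH (π : EvenRegionParamsH) (h : (T.evenCertH π).check = true) :
    TaylorEvenRegion T.α T.box ((T.E₀ : ℚ) : ℝ) :=
  taylorEvenRegion_of_certH (T.evenCertH π) h

/-- [folklore] -/
theorem oddCone_of_oddCertH (π : OddConeParamsH) (h : (T.oddCertH π).check = true) : T.OddCone :=
  oddCone_of_certH (T.oddCertH π) h

/-- **`BoxExcluded` from the table check, the enclosure hypothesis and two EXACT region certificates.** [folklore] -/
theorem boxExcluded_of_taylorTable_of_certsH (h : T.check = true) (hEnc : T.Enclosures)
    (πE : EvenRegionParamsH) (hE : (T.evenCertH πE).check = true)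
    (πO : OddConeParamsH) (hO : (T.oddCertH πO).check = true) : BoxExcluded T.box :=
  T.boxExcluded_of_taylorTable_of_fields h hEnc (T.evenRegion_of_evenCertH πE hE) (T.oddCone_of_oddCertH πO hO)

end TaylorTable

/-! ### Fixture: the hybrid pipeline runs in the kernel (toy `Λ = 1`) -/

/-- Toy hybrid even certificate: `E₀ = 4`, rows `j ≤ 8` on `[4, 8]`, tail from `E₁ = 8`. [folklore] -/
def toyEvenRegionCertH : EvenRegionCertH where
  S := 1024
  box := ⟨1 / 2, 51 / 100, 3 / 2, 151 / 100⟩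
  l := [(1, 0)]
  cQ := fun i _ => if i = 0 ∨ i = 1 then 1 else 0
  E0 := 4
  E1 := 8
  J1 := 8
  ccQ := 0
  N := 2
  R := 5
  prmX := ⟨1, 8, 1, 3⟩
  prmY := ⟨1, 8, 1, 3⟩
  prmD := ⟨1, 8, 1, 3⟩
  dPj := 3

/-- [folklore] -/
theorem toyEvenRegionCertH_check : toyEvenRegionCertH.check = true := by
  decide +kernel

/-- Toy hybrid odd certificate. [folklore] -/
def toyOddConeRegionCertH : OddConeRegionCertH where
  S := 1024
  box := ⟨1 / 2, 1 / 2, 3 / 2, 3 / 2⟩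
  l := [(1, 0)]
  cQ := fun i _ => if i = 3 then 1 else 0
  lψ := [(0, 0)]
  ψQ := fun _ => 1
  κ₀Q := 1
  k1lo := ⟨2, 1, ⟨256, 256⟩⟩
  k1hi := ⟨2, 1, ⟨256, 256⟩⟩
  k2lo := ⟨1, 1, ⟨512, 512⟩⟩
  k2hi := ⟨1, 1, ⟨512, 512⟩⟩
  k3lo := ⟨3, 1, ⟨8192, 8192⟩⟩
  k3hi := ⟨3, 1, ⟨8192, 8192⟩⟩
  E0 := 4
  E1 := 8
  J1 := 8
  ccQ := 0
  N := 2
  R := 5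
  prmM1 := ⟨1, 8, 1, 3⟩
  prmM2 := ⟨1, 8, 1, 3⟩
  prmR1 := ⟨1, 8, 1, 3⟩
  prmR2 := ⟨1, 8, 1, 3⟩
  dPj := 3

/-- [folklore] -/
theorem toyOddConeRegionCertH_check : toyOddConeRegionCertH.check = true := by
  decide +kernel

end Summit.CriticalPhenomena.Ising3D
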